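import Literature.NumberTheory.GaloisRepresentations.LocalGlobalCohomologyDualityProofs
import Mathlib.RingTheory.Artinian.Ring
import Mathlib.NumberTheory.Padics.RingHoms
import Mathlib.LinearAlgebra.FreeModule.Finite.Basic
import HarnessLib

/-!
# A finite chain ring is Frobenius: one additive character `λ : R → ℤ/n` with `r ↦ λ(r ·)` a bijection
# `R ≅ Hom_ℤ(R, ℤ/n)` (theorems only)

Topic `RingTheory/CompleteLocalRings` (sequel to `ChainRingAdditiveGenerators`).  THEOREMS ONLY: no definition, no
named fact, no instance, no `sorry`.

A CHAIN RING is a local ring `R` with principal maximal ideal `𝔪 = (π)`; if `R` is finite (more generally Artinian)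
then `π` is nilpotent, every non-zero element is `u π^i` with `u` a unit (`exists_unit_mul_pow_eq_of_ne_zero`), and the
socle `π^{N-1} R` (`N` the nilpotency index) lies in every non-zero ideal (`exists_mul_eq_pow_of_ne_zero`: every
non-zero `r` DIVIDES `π^{N-1}`).  Consequently `R` is a FROBENIUS ring: for any additive character `λ : R → ℤ/n`
(`n · R = 0`) which does not kill the socle, the symmetric form `(r, s) ↦ λ(r s)` has trivial kernels, hence — `R`
and `Hom(R, ℤ/n)` having the same order (tree `Nat.card_addMonoidHom_zmod`, `AddMonoidHom.bijective_of_injective_of_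
injective_flip`) — **`r ↦ λ(r ·) : R → Hom_ℤ(R, ℤ/n)` is a bijection** (`bijective_mul_compr₂_of_apply_pow_ne_zero`);
such a `λ` exists (`exists_addMonoidHom_zmod_bijective_mul_compr₂`, characters of a finite abelian group separate
points).  [Wood 1999, Thm. 3.10 «finite chain rings are Frobenius»; Lam, *Lectures on Modules and Rings*, (16.56);
McDonald, *Finite Rings with Identity*, XVII.]

For a finite free `R`-module `M` this is the DUALIZING property «`Hom_R(M, R) ≅ Hom_ℤ(M, ℤ/n)` under `φ ↦ λ ∘ φ`»
(`bijective_comp_linearMap_of_free`) — VERBATIM the binder `hlamb` of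
`Howard2004/DualityDatumTateDualBijective.toTateDual_bijective` (Howard 2004 §2.1 «`Hom_{S_𝔭}(N, 𝒟_𝔭(1)) ≅
Hom_{ℤ_p}(N, μ_{p^∞})`»), now for EVERY level ring `R/𝔪^e` of EVERY `DVRSetting` and for the refined levels
`R/π^{i+1}` (cell `pub/bsd-print-x9`, FINDING «READ-NONFREE»: the dualizing-FAMILY binder `hbij` of the reading files
needs `(R, +)` free over `ℤ/p^k`, which `R/π^{i+1}` is not for ramified `R`; the Frobenius character needs nothing).
The `ℤ_p`-semilinearity clause `hlam` of those files is automatic for any additive `λ` when `p^k · R = 0`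
(`apply_algebraMap_mul_eq_toZModPow_mul`).

Cell `pub/bsd-print-x9`, G87 = Howard 2004 Thm. 1.6.1 (print leaf `stub_h161` of stmt-BirchSwinnertonDyer-22642); seat
`bsd-line-x10b-p1-w6` g9, brick (FROB-CHAR).  Pure algebra; BSD is not proved by any of this.

References: [Wood1999DualityCodesFiniteRings] J. A. Wood, *Duality for modules over finite rings and applications to
coding theory*, Amer. J. Math. 121 (1999), Thm. 3.10; [Lam1999] T. Y. Lam, *Lectures on Modules
and Rings*, GTM 189 (1999), §16 (16.56); [McDonald1974FiniteRings] B. R. McDonald, *Finite Rings with Identity* (1974),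
Ch. XVII; [Howard2004HeegnerKolyvagin] B. Howard, Compositio Math. 140 (2004), §2.1 (arXiv:1202.6340 p. 13 L20–24);
[MilneADT2006] J. S. Milne, *Arithmetic Duality Theorems*, I §0 Prop. 0.19.
-/

set_option autoImplicit false

namespace Literature.RingTheory.CompleteLocalRings

open Function IsLocalRing
open Literature.NumberTheory.GaloisRepresentations

variable {R : Type*} [CommRing R] [IsLocalRing R]

/-! ## §1 Chain rings: `r = u π^i`, and every non-zero element divides the socle generator -/

/-- In a local ring with principal maximal ideal `(π)`, `π` nilpotent, **every non-zero `r` is `u · π^i` with `u` a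
unit** (and `π^i ≠ 0`): take `i` maximal with `r ∈ (π^i)`. [cite: McDonald1974FiniteRings, Ch. XVII (chain rings)] -/
theorem exists_unit_mul_pow_eq_of_ne_zero {π : R} (hπ : maximalIdeal R = Ideal.span {π}) (hnil : IsNilpotent π)
    {r : R} (hr : r ≠ 0) : ∃ (i : ℕ) (u : Rˣ), (u : R) * π ^ i = r ∧ π ^ i ≠ 0 := by
  classical
  obtain ⟨N, hN⟩ := hnil
  have hex : ∃ j : ℕ, r ∉ Ideal.span {π ^ j} :=
    ⟨N, by rw [hN, Ideal.span_singleton_zero]; exact hr⟩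
  let j := Nat.find hex
  have hj : r ∉ Ideal.span {π ^ j} := Nat.find_spec hex
  have hj0 : j ≠ 0 := by
    intro h0
    apply hj
    rw [h0, pow_zero, Ideal.span_singleton_one]
    exact Submodule.mem_top
  obtain ⟨i, hi⟩ : ∃ i, j = i + 1 := Nat.exists_eq_succ_of_ne_zero hj0
  have hri : r ∈ Ideal.span {π ^ i} := by
    by_contra h
    have := Nat.find_min hex (show i < j by omega)
    exact this h
  obtain ⟨s, hs⟩ := Ideal.mem_span_singleton'.1 hri
  -- `s` is a unit: otherwise `s ∈ (π)` and `r ∈ (π^(i+1))`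
  have hsu : IsUnit s := by
    by_contra hns
    have hsm : s ∈ maximalIdeal R := (mem_maximalIdeal s).2 hns
    rw [hπ] at hsm
    obtain ⟨t, ht⟩ := Ideal.mem_span_singleton'.1 hsm
    apply hj
    rw [hi]
    refine Ideal.mem_span_singleton'.2 ⟨t, ?_⟩
    rw [← hs, ← ht, pow_succ]
    ring
  refine ⟨i, hsu.unit, by rw [IsUnit.unit_spec]; exact hs, fun h0 => hr ?_⟩
  rw [← hs, h0, mul_zero]

/-- **Every non-zero element of a chain ring divides the socle generator**: with `N` the nilpotency index of `π`
(`π^N = 0`, `π^{N-1} ≠ 0`), every `r ≠ 0` has a multiple equal to `π^{N-1}` — the socle `π^{N-1}R` lies in every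
non-zero ideal. [cite: McDonald1974FiniteRings, Ch. XVII (chain rings)] [cite: Lam1999, §16 (16.56)] -/
theorem exists_mul_eq_pow_of_ne_zero {π : R} (hπ : maximalIdeal R = Ideal.span {π}) {N : ℕ} (hN : π ^ N = 0)
    (hN' : ∀ m < N, π ^ m ≠ 0) {r : R} (hr : r ≠ 0) : ∃ t : R, r * t = π ^ (N - 1) := by
  obtain ⟨i, u, hur, hi⟩ := exists_unit_mul_pow_eq_of_ne_zero hπ ⟨N, hN⟩ hr
  -- `i < N` since `π^i ≠ 0`
  have hiN : i < N := by
    by_contra h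
    exact hi (by rw [← Nat.sub_add_cancel (not_lt.1 h), pow_add, hN, mul_zero])
  have _ := hN' -- (the minimality is only needed by callers to know `π^(N-1) ≠ 0`)
  refine ⟨(u⁻¹ : Rˣ) * π ^ (N - 1 - i), ?_⟩
  rw [← hur, mul_assoc, ← mul_assoc (π ^ i), mul_comm (π ^ i), mul_assoc, ← pow_add,
    ← mul_assoc, Units.mul_inv, one_mul]
  congr 1
  omega

/-- In a FINITE local ring every element of the maximal ideal is nilpotent (the ring is Artinian, its Jacobson
radical `𝔪` is nilpotent). [cite: McDonald1974FiniteRings, Ch. XVII] -/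
theorem isNilpotent_of_mem_maximalIdeal [Finite R] {π : R} (hπ : π ∈ maximalIdeal R) : IsNilpotent π := by
  haveI : IsArtinianRing R := isArtinian_of_finite
  obtain ⟨N, hN⟩ := IsArtinianRing.isNilpotent_jacobson_bot (R := R)
  rw [jacobson_eq_maximalIdeal (⊥ : Ideal R) bot_ne_top] at hN
  refine ⟨N, ?_⟩
  have h : π ^ N ∈ (maximalIdeal R) ^ N := Ideal.pow_mem_pow hπ N
  rw [hN] at h
  exact (Submodule.mem_bot R).1 h

/-! ## §2 The Frobenius character -/

/-- **A character not killing the socle is a Frobenius form**: in a chain ring with `π^N = 0 ≠ π^{N-1}` and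
`n · R = 0`, `n ≠ 0`, an additive `λ : R → ℤ/n` with `λ(π^{N-1}) ≠ 0` makes `r ↦ λ(r ·) : R → Hom_ℤ(R, ℤ/n)` a
BIJECTION: the kernel is an ideal missing the socle, hence zero; `|Hom(R, ℤ/n)| = |R|`.
[cite: Wood1999DualityCodesFiniteRings, Thm. 3.10] [cite: Lam1999, §16 (16.56)] [cite: MilneADT2006, Ch. I §0 Prop. 0.19 (d)] -/
theorem bijective_mul_compr₂_of_apply_pow_ne_zero [Finite R] {π : R} (hπ : maximalIdeal R = Ideal.span {π})
    {N : ℕ} (hN : π ^ N = 0) (hN' : ∀ m < N, π ^ m ≠ 0) {n : ℕ} [NeZero n] (hn : ∀ r : R, n • r = 0)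
    (lam : R →+ ZMod n) (hlam : lam (π ^ (N - 1)) ≠ 0) :
    Bijective ((AddMonoidHom.mul : R →+ R →+ R).compr₂ lam) := by
  set b := (AddMonoidHom.mul : R →+ R →+ R).compr₂ lam with hb
  have hb_apply : ∀ r s : R, b r s = lam (r * s) := fun r s => rfl
  -- trivial left kernel
  have hinj : Injective b := by
    refine (injective_iff_map_eq_zero b).2 fun r hr => ?_
    by_contra hr0
    obtain ⟨t, ht⟩ := exists_mul_eq_pow_of_ne_zero hπ hN hN' hr0
    apply hlam
    rw [← ht, ← hb_apply, hr, AddMonoidHom.zero_apply]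
  -- trivial right kernel (commutativity)
  have hinj' : Injective b.flip := by
    refine (injective_iff_map_eq_zero b.flip).2 fun s hs => ?_
    by_contra hs0
    obtain ⟨t, ht⟩ := exists_mul_eq_pow_of_ne_zero hπ hN hN' hs0
    apply hlam
    rw [← ht, mul_comm, ← hb_apply, ← AddMonoidHom.flip_apply b, hs, AddMonoidHom.zero_apply]
  exact (AddMonoidHom.bijective_of_injective_of_injective_flip hn hn b hinj hinj').1

/-- **A finite chain ring is Frobenius** (Wood, Thm. 3.10): for a finite local ring `R` with principal maximal ideal
and `n · R = 0` (`n ≠ 0`) there is an additive character `λ : R → ℤ/n` with `r ↦ λ(r ·) : R → Hom_ℤ(R, ℤ/n)`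
BIJECTIVE (any character not killing the socle `π^{N-1} ≠ 0`; one exists since the characters of a finite abelian
group killed by `n` separate points, tree `exists_addMonoidHom_zmod_apply_ne_zero`).
[cite: Wood1999DualityCodesFiniteRings, Thm. 3.10] [cite: Lam1999, §16 (16.56)] -/
theorem exists_addMonoidHom_zmod_bijective_mul_compr₂ [Finite R] (hprinc : (maximalIdeal R).IsPrincipal) {n : ℕ}
    [NeZero n] (hn : ∀ r : R, n • r = 0) :
    ∃ lam : R →+ ZMod n, Bijective ((AddMonoidHom.mul : R →+ R →+ R).compr₂ lam) := by
  classical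
  obtain ⟨π, hπ⟩ := hprinc
  have hπ' : maximalIdeal R = Ideal.span {π} := hπ
  have hnil : IsNilpotent π :=
    isNilpotent_of_mem_maximalIdeal (by rw [hπ']; exact Ideal.mem_span_singleton_self π)
  -- the nilpotency index `N` of `π`
  let N := Nat.find hnil
  have hN : π ^ N = 0 := Nat.find_spec hnil
  have hN' : ∀ m < N, π ^ m ≠ 0 := fun m hm => Nat.find_min hnil hm
  have hN0 : N ≠ 0 := by
    intro h0
    have h1 : π ^ N = 1 := by rw [h0, pow_zero]
    exact one_ne_zero (h1.symm.trans hN)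
  have hsoc : π ^ (N - 1) ≠ 0 := hN' (N - 1) (by omega)
  obtain ⟨lam, hlam⟩ := exists_addMonoidHom_zmod_apply_ne_zero hn hsoc
  exact ⟨lam, bijective_mul_compr₂_of_apply_pow_ne_zero hπ' hN hN' hn lam hlam⟩

/-- Pointwise form of the Frobenius property: `r ↦ λ ∘ (r ·)` is a bijection `R → Hom_ℤ(R, ℤ/n)`.
[cite: Wood1999DualityCodesFiniteRings, Thm. 3.10] -/
theorem exists_addMonoidHom_zmod_bijective_comp_mulLeft [Finite R] (hprinc : (maximalIdeal R).IsPrincipal) {n : ℕ}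
    [NeZero n] (hn : ∀ r : R, n • r = 0) :
    ∃ lam : R →+ ZMod n, Bijective fun r : R => lam.comp (AddMonoidHom.mulLeft r) :=
  exists_addMonoidHom_zmod_bijective_mul_compr₂ hprinc hn

/-! ## §3 The dualizing property for free modules, and `ℤ_p`-semilinearity -/

omit [IsLocalRing R] in
/-- **`Hom_R(M, R) ≅ Hom_ℤ(M, ℤ/n)` under `φ ↦ λ ∘ φ`** for a finite free `R`-module `M` and a Frobenius character `λ`
(`r ↦ λ(r ·)` bijective): injective since `λ(φ(m) r) = λ(φ(r m))`, surjective by solving `λ(c_i ·) = ψ(· b_i)` on a basis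
`(b_i)`.  This is the binder `hlamb` of `Howard2004/DualityDatumTateDualBijective.toTateDual_bijective`
(Howard 2004 §2.1 «`Hom_{S_𝔭}(N, 𝒟_𝔭(1)) ≅ Hom_{ℤ_p}(N, μ_{p^∞})`»).
[cite: Howard2004HeegnerKolyvagin, §2.1 (arXiv:1202.6340 p. 13 L20–24)] [cite: Wood1999DualityCodesFiniteRings, Thm. 3.10] -/
theorem bijective_comp_linearMap_of_free {M : Type*} [AddCommGroup M] [Module R M] [Module.Free R M]
    [Module.Finite R M] {n : ℕ} (lam : R →+ ZMod n)
    (hlam : Bijective ((AddMonoidHom.mul : R →+ R →+ R).compr₂ lam)) :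
    Bijective fun φ : M →ₗ[R] R => lam.comp φ.toAddMonoidHom := by
  classical
  have hb_apply : ∀ r s : R, (AddMonoidHom.mul : R →+ R →+ R).compr₂ lam r s = lam (r * s) := fun r s => rfl
  constructor
  · -- injective
    intro φ ψ hφψ
    have h : ∀ m, lam (φ m) = lam (ψ m) := fun m => congrArg (fun f : M →+ ZMod n => f m) hφψ
    refine LinearMap.ext fun m => ?_
    apply hlam.1
    refine AddMonoidHom.ext fun r => ?_
    rw [hb_apply, hb_apply, mul_comm (φ m), mul_comm (ψ m), ← smul_eq_mul, ← smul_eq_mul, ← map_smul,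
      ← map_smul]
    exact h (r • m)
  · -- surjective
    intro ψ
    let bs := Module.Free.chooseBasis R M
    haveI : Fintype (Module.Free.ChooseBasisIndex R M) := Module.Free.ChooseBasisIndex.fintype R M
    -- solve `λ(c_i ·) = ψ(· • b_i)` for each basis vector
    have hc : ∀ i, ∃ c : R, (AddMonoidHom.mul : R →+ R →+ R).compr₂ lam c =
        ψ.comp ((LinearMap.toSpanSingleton R M (bs i)).toAddMonoidHom) := fun i => hlam.2 _
    choose c hc using hc
    have hc' : ∀ i (r : R), lam (c i * r) = ψ (r • bs i) := fun i r => by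
      have := congrArg (fun f : R →+ ZMod n => f r) (hc i)
      simpa only [hb_apply, AddMonoidHom.coe_comp, Function.comp_apply, LinearMap.toAddMonoidHom_coe,
        LinearMap.toSpanSingleton_apply] using this
    refine ⟨bs.constr ℤ c, AddMonoidHom.ext fun m => ?_⟩
    change lam ((bs.constr ℤ c) m) = ψ m
    conv_rhs => rw [← bs.sum_repr m]
    rw [bs.constr_apply, Finsupp.sum_fintype (bs.repr m) (fun i a => a • c i) (fun _ => zero_smul _ _),
      map_sum, map_sum]
    refine Finset.sum_congr rfl fun i _ => ?_
    rw [smul_eq_mul, mul_comm, hc' i]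

omit [IsLocalRing R] in
/-- **`ℤ_p`-semilinearity of additive characters is automatic**: if `p^k · R = 0` then for every additive
`λ : R → ℤ/p^k`, `λ(z · r) = (z mod p^k) · λ(r)` for `z ∈ ℤ_p` (write `z = a + p^k w` with `a ∈ ℕ`).  This is the binder
`hlam` of the `Howard2004/DualityDatum*` reading files. [cite: Howard2004HeegnerKolyvagin, §1.3 H.4 (arXiv:1202.6340 p. 7 L78–82)] -/
theorem apply_algebraMap_mul_eq_toZModPow_mul {p : ℕ} [Fact p.Prime] [Algebra ℤ_[p] R] {k : ℕ}
    (hk : ∀ r : R, p ^ k • r = 0) (lam : R →+ ZMod (p ^ k)) (z : ℤ_[p]) (r : R) :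
    lam (algebraMap ℤ_[p] R z * r) = PadicInt.toZModPow k z * lam r := by
  -- `z = a + p^k w` with `a = (z mod p^k).val`
  set a : ℕ := (PadicInt.toZModPow k z).val with ha
  have hza : z - (a : ℤ_[p]) ∈ RingHom.ker (PadicInt.toZModPow k) := by
    rw [RingHom.mem_ker, map_sub, map_natCast, ha, ZMod.natCast_zmod_val, sub_self]
  rw [PadicInt.ker_toZModPow] at hza
  obtain ⟨w, hw⟩ := Ideal.mem_span_singleton'.1 hza
  have hz : z = (a : ℤ_[p]) + w * (p : ℤ_[p]) ^ k := by rw [hw]; ring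
  have hpk : algebraMap ℤ_[p] R ((p : ℤ_[p]) ^ k) * (algebraMap ℤ_[p] R w * r) = 0 := by
    rw [map_pow, map_natCast, ← Nat.cast_pow, ← nsmul_eq_mul]
    exact hk _
  have hz' : algebraMap ℤ_[p] R z = (a : R) + algebraMap ℤ_[p] R ((p : ℤ_[p]) ^ k) * algebraMap ℤ_[p] R w := by
    rw [hz, (algebraMap ℤ_[p] R).map_add, map_natCast, (algebraMap ℤ_[p] R).map_mul, mul_comm]
  calc lam (algebraMap ℤ_[p] R z * r)
      = lam ((a : R) * r + algebraMap ℤ_[p] R ((p : ℤ_[p]) ^ k) * (algebraMap ℤ_[p] R w * r)) := by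
        rw [hz', add_mul, mul_assoc]
    _ = (a : ZMod (p ^ k)) * lam r := by
        rw [hpk, add_zero, ← nsmul_eq_mul, map_nsmul, nsmul_eq_mul]
    _ = PadicInt.toZModPow k z * lam r := by rw [ha, ZMod.natCast_zmod_val]

end Literature.RingTheory.CompleteLocalRings
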